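import Literature.MathematicalPhysics.QuantumFieldTheory.Balaban1983to89.Node00.Record12BgRowAnalysis
import Literature.MathematicalPhysics.QuantumFieldTheory.Balaban1983to89.Node00.Record12BgRowGaugeAxial
import Literature.MathematicalPhysics.QuantumFieldTheory.Balaban1983to89.T4ExpWindowSmallField
import Literature.MathematicalPhysics.QuantumFieldTheory.Balaban1983to89.T4WilsonLinkAffine

/-!
# BalabanUVNodes ∕ N07 ([Balaban1985Variational] Theorem 1 (7)–(8) p. 279, in node00-def-P11's typed readings at the objects of record) —
# THE INTERFACE INSTANCE: a one-step (2.18) index `Ω₁ = Λ₁ =` one `𝐃₁`-cube, its CORNER PLAQUETTE `p` (touching `Ω₁`, all four bonds sourced in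
# `Γ₀ = Ω₁ᶜ`), and a single-bond datum — at which «a minimiser of (2.12) exists ∧ every minimiser is `B₃δ_nη_n²`-regular on the plaquettes touching
# `Ω_n`» FAILS for every class, every averaging and every `(B₃, δ)` with `B₃δ₁η₁² ≤ dist1 (W₀(∂p))` (companion `…N07Thm1ScaledInterfaceObstruction` reads it)

HEADLINE.  Work toward ONE FINITE-LATTICE STEP of Bałaban's programme — the typed RANGE of [15] Thm 1 at NODE 00's objects (cell `pub-ymgap`, Track A, DAG
node **N07** = [15] = [Balaban1985Variational]; seat `pub-ymgap-dag-n07-e`, generation 6; `--supports stmt-QuantumFields-19909 --as helper`, the ROW-P11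
negative-certificate lane).  THEOREMS ONLY (0 `def`, 0 `sorry`, 0 `instance`; instances packaged as `∃`).  Located target: director-ym LINE №136 ∕ dag-lead
WORDS-137 («`VariationalThm1Scaled`-false — no certificate exists»), node00-def-P11 LOCATED-P11-SEQ (ii) and `Node00/Record12BgRowAnalysis` §8.

THE MECHANISM (purely combinatorial — no Stokes, no [15] Prop. 2, no minimiser is computed).  In node00-def-P11's readings the datum `W` is small on the
plaquettes TOUCHING `Γ_n(s)` and the conclusion (R) bounds the minimiser on the plaquettes TOUCHING `Ω_n(s)` ([6] p. 77 convention,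
`B8Eq17ClassAkV1.plaqsOf`).  Take `k = 1` and `Ω₁ = Λ₁ = D = cubeEnl P (L·M·R₁) 0 0` (at `M = 1`, `r = 0`: side `L < 2L^{m+K}`, no wrapping).  The fine
plaquette `p = ⟨x, e₀, e₁⟩` whose far corner `x + e₀ + e₁` is the cube's corner has `p ∈ omegaPlaqs s.Ω 1 = plaqsOf D`, while `x, x + e₀, x + e₁ ∉ D`,
so all four bonds of `p` lie in `bondsOf (genSet s.Ω 1 0) = bondsOf Dᶜ` (`gammaRegion_zero`; scale `0`, `Averaging.iter _ 0 = id`): the (2.10) constraint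
PINS `U(∂p) = W₀(∂p)` for EVERY constrained `U` (`plaqHol_eq_of_agreeOn`).  With `W₀` the single-bond field at `⟨x, e₀⟩` with value `h` (every plaquette
holonomy in `{1, h, h⁻¹}`, `dist1_plaqHol_single_le`; `W₀(∂p) = h`, `plaqHol_single_eq`) and `W_j = 1` for `j ≥ 1`, the regularity clause at `n = 1`
reads `dist1 h < B₃δ₁η₁²` — false once `B₃δ₁η₁² ≤ dist1 h` (`not_exists_isMinimizer_and_regular`, ANY class ∕ averaging ∕ `k ≥ 1`).  `su2_dist1_surj`:
on `SU(2)` every `t ∈ [0, 2]` is a `dist1` (adapted from the cell's Summits-side `ShellMeasureLevelZeroShellMass.exists_dist1_eq`, not importable here).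

HONEST FRAMING.  Lattice bookkeeping about the tree's own objects; NOTHING of [15] asserted or refuted here (the refutations of the TYPED READINGS are the
companion's); count-neutral; N07 ∕ K0‴ NOT discharged (typed 28∕28 · discharged 5∕28 unmoved); one finite `𝕋⁴` programme at fixed `ε = L^{−K}` — NOT
continuum ∕ ℝ⁴ ∕ OS ∕ mass gap ∕ Clay.

DEPENDENCES (by name, nothing modified): node00-def-P11 `Sect2.SeqSeparated`, `cubeEnl_zero_eq ∕ boxLo ∕ boxHi`; node00-def-R `SeqOfRecord ∕ DOfRecord ∕
unionsOfCubes ∕ dCubeSide ∕ omegaPlaqs`; node00-def `RkOfRecord ∕ cubeIndices ∕ cubeEnl ∕ Stage7Numerics`; r11 `B14.Eq218Concrete.Seq.ofChain ∕ Chain21`;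
r12 `B15DeterminingSets` (`genSet ∕ gammaRegion_zero ∕ pts_zero ∕ bondsOf ∕ AgreeOn ∕ avgFamily ∕ IsMinimizer`); pv26 `T4AxialGaugeSmallField.castSite ∕
castSite_add_e`; `T4WilsonLinkAffine.shift_ne_self`; `T4HaarSU2ExpChart.expPoint`, `T4ExpWindowSmallField.dist1_expPoint_eq`; `B8Eq17ClassAkV1.plaqsOf`; `Setup`.
-/

noncomputable section

namespace Summit.QuantumFields.YangMills.BalabanUVNodes.N07Thm1ScaledInterfaceInstance

open Literature.MathematicalPhysics.QuantumFieldTheory.Balaban1983to89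
open Literature.MathematicalPhysics.QuantumFieldTheory.Balaban1983to89.T4Continuum (T4Family)
open Literature.MathematicalPhysics.QuantumFieldTheory.Balaban1983to89.Node00
open Literature.MathematicalPhysics.QuantumFieldTheory.Balaban1983to89.B15DeterminingSets
open Literature.MathematicalPhysics.QuantumFieldTheory.Balaban1983to89.T4AxialGaugeSmallField (castSite castSite_add_e castSite_apply)
open Literature.MathematicalPhysics.QuantumFieldTheory.Balaban1983to89.B7Prop1Explicit (e e_apply)
open B14.Eq218Concrete (Seq Chain21)
open scoped Matrix.Norms.L2Operator

/-! ## §1  `SU(2)`: `dist1` takes every value in `[0, 2]` -/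

/-- On `SU(2)` every `t ∈ [0, 2]` is a distance from `1`: `dist1 (expPoint x) = 2|sin(‖x‖∕2)|` at `‖x‖ = 2·arcsin(t∕2)` (adapted from the cell's
Summits-side `ShellMeasureLevelZeroShellMass.exists_dist1_eq`). [folklore] -/
theorem su2_dist1_surj : ∀ t : ℝ, 0 ≤ t → t ≤ 2 → ∃ g : SU 2, dist1 g = t := by
  intro t h0 h2
  refine ⟨T4HaarSU2ExpChart.expPoint (PiLp.single 2 (0 : Fin 3) (2 * Real.arcsin (t / 2))), ?_⟩
  have ha0 : 0 ≤ Real.arcsin (t / 2) := Real.arcsin_nonneg.2 (by linarith)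
  have haπ : Real.arcsin (t / 2) ≤ Real.pi / 2 := Real.arcsin_le_pi_div_two _
  have hn : ‖(PiLp.single 2 (0 : Fin 3) (2 * Real.arcsin (t / 2)) : EuclideanSpace ℝ (Fin 3))‖ =
      2 * Real.arcsin (t / 2) := by
    rw [PiLp.norm_single, Real.norm_eq_abs, abs_of_nonneg (by linarith)]
  have hsin : 0 ≤ Real.sin (Real.arcsin (t / 2)) :=
    Real.sin_nonneg_of_nonneg_of_le_pi ha0 (by linarith [Real.pi_pos])
  rw [T4ExpWindowSmallField.dist1_expPoint_eq, hn, mul_div_cancel_left₀ _ (two_ne_zero), abs_of_nonneg hsin,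
    Real.sin_arcsin (by linarith) (by linarith)]
  ring

/-! ## §2  Lattice bookkeeping: the single-bond datum and its plaquettes (`x + e_μ ≠ x` is `T4WilsonLinkAffine.shift_ne_self`) -/

section Lattice

variable {P : Params} {j : ℕ} {G : Type*} [GaugeGroup G]

/-- **The single-bond datum at `⟨x, μ₀⟩` evaluates to `h` on the plaquette `⟨x, μ₀, μ₁⟩`.** [folklore] -/
theorem plaqHol_single_eq (x : Site P j) {μ0 μ1 : Fin P.d} (hμ : μ0 < μ1) (h : G) :
    GaugeField.plaqHol (fun b : PBond P j => if b.src = x ∧ b.dir = μ0 then h else 1) ⟨x, μ0, μ1, hμ⟩ = h := by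
  have hne : μ1 ≠ μ0 := ne_of_gt hμ
  show (if x = x ∧ μ0 = μ0 then h else 1) * (if x.shift μ0 = x ∧ μ1 = μ0 then h else 1) *
      (if x.shift μ1 = x ∧ μ0 = μ0 then h else 1)⁻¹ * (if x = x ∧ μ1 = μ0 then h else 1)⁻¹ = h
  rw [if_pos ⟨rfl, rfl⟩, if_neg (show ¬(x.shift μ0 = x ∧ μ1 = μ0) from fun hc => hne hc.2),
    if_neg (show ¬(x = x ∧ μ1 = μ0) from fun hc => hne hc.2),
    if_neg (show ¬(x.shift μ1 = x ∧ μ0 = μ0) from fun hc => T4WilsonLinkAffine.shift_ne_self x μ1 hc.1)]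
  simp

/-- **Every plaquette holonomy of the single-bond datum lies in `{1, h, h⁻¹}`** (for `μ₀` the least direction): its `dist1` is at most `dist1 h`. [folklore] -/
theorem dist1_plaqHol_single_le (x : Site P j) {μ0 : Fin P.d} (hμ0 : ∀ ν : Fin P.d, ¬ ν < μ0) (h : G) (q : Plaq P j) :
    dist1 (GaugeField.plaqHol (fun b : PBond P j => if b.src = x ∧ b.dir = μ0 then h else 1) q) ≤ dist1 h := by
  have hν : q.ν ≠ μ0 := fun hq => hμ0 q.μ (hq ▸ q.hμν)
  show dist1 ((if q.src = x ∧ q.μ = μ0 then h else 1) * (if q.src.shift q.μ = x ∧ q.ν = μ0 then h else 1) *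
      (if q.src.shift q.ν = x ∧ q.μ = μ0 then h else 1)⁻¹ * (if q.src = x ∧ q.ν = μ0 then h else 1)⁻¹) ≤ dist1 h
  rw [if_neg (show ¬(q.src.shift q.μ = x ∧ q.ν = μ0) from fun hc => hν hc.2),
    if_neg (show ¬(q.src = x ∧ q.ν = μ0) from fun hc => hν hc.2)]
  have h0 : 0 ≤ dist1 h := GaugeGroup.dist1_nonneg h
  split_ifs <;> simp [GaugeGroup.dist1_one, GaugeGroup.dist1_inv, h0]

end Lattice

/-! ## §3  The non-wrapping cube of index `0` and its corner plaquette -/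

section Corner

variable {P : Params}

/-- The origin of the cover lies in the `s`-cube of index `0` (`1 ≤ s`). [cite: Balaban1988Convergent, (2.1) p.254 (bookkeeping)] -/
theorem castSite_zero_mem_cubeEnl {s : ℕ} (hs : 1 ≤ s) : (castSite (0 : Fin P.d → ℤ) : Site P 0) ∈ cubeEnl P s 0 0 := by
  rw [cubeEnl_zero_eq]
  have hs' : (1 : ℤ) ≤ s := by exact_mod_cast hs
  refine ⟨0, ⟨fun κ => ?_, fun κ => ?_⟩, rfl⟩
  · simp [boxLo]
  · simp only [boxHi, Pi.zero_apply, mul_zero, zero_add]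
    linarith

/-- **No wrapping**: a point of the cover with a coordinate `−1` does not project into the `s`-cube of index `0` when `s < 2L^{m+K}` (the step back from the
corner does not re-enter the cube through the torus). [cite: Balaban1988Convergent, (2.1) p.254 (bookkeeping)] -/
theorem castSite_notMem_cubeEnl {s : ℕ} (hsN : (s : ℤ) < P.sitesPerDir 0) {w : Fin P.d → ℤ} {i : Fin P.d} (hi : w i = -1) :
    (castSite w : Site P 0) ∉ cubeEnl P s 0 0 := by
  rw [cubeEnl_zero_eq]
  rintro ⟨z, ⟨hlo, hhi⟩, hz⟩
  have hzi := congr_fun hz i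
  simp only [castSite_apply] at hzi
  rw [ZMod.intCast_eq_intCast_iff_dvd_sub, hi] at hzi
  have h1 : 0 ≤ z i := by simpa [boxLo] using hlo i
  have h2 : z i ≤ (s : ℤ) - 1 := by simpa [boxHi] using hhi i
  obtain ⟨c, hc⟩ := hzi
  have hn : (0 : ℤ) < P.sitesPerDir 0 := by exact_mod_cast Nat.pos_of_ne_zero (P.sitesPerDir_ne_zero 0)
  rcases le_or_gt 0 c with hc0 | hc0
  · have : (0 : ℤ) ≤ (P.sitesPerDir 0 : ℤ) * c := mul_nonneg hn.le hc0
    linarith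
  · have hc1 : c ≤ -1 := by omega
    have : (P.sitesPerDir 0 : ℤ) * c ≤ (P.sitesPerDir 0 : ℤ) * (-1) := mul_le_mul_of_nonneg_left hc1 hn.le
    linarith

/-- **THE CORNER PLAQUETTE** of the `s`-cube `D` of index `0` (`1 ≤ s < 2L^{m+K}`, `d ≥ 2`): a fine plaquette `p = ⟨x, μ₀, μ₁⟩`, `μ₀` the least direction, whose
far corner `x + e_{μ₀} + e_{μ₁}` lies in `D` while `x`, `x + e_{μ₀}`, `x + e_{μ₁}` do not. [cite: Balaban1985RegularSpaces, p.77 (convention before (1.5); bookkeeping)] -/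
theorem exists_cornerPlaq {s : ℕ} (hs : 1 ≤ s) (hsN : (s : ℤ) < P.sitesPerDir 0) (hd : 2 ≤ P.d) :
    ∃ p : Plaq P 0, (p.src.shift p.μ).shift p.ν ∈ cubeEnl P s 0 0 ∧ p.src ∉ cubeEnl P s 0 0 ∧
      p.src.shift p.μ ∉ cubeEnl P s 0 0 ∧ p.src.shift p.ν ∉ cubeEnl P s 0 0 ∧ ∀ ν : Fin P.d, ¬ ν < p.μ := by
  let μ0 : Fin P.d := ⟨0, by omega⟩
  let μ1 : Fin P.d := ⟨1, by omega⟩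
  have hμ : μ0 < μ1 := Fin.mk_lt_mk.mpr zero_lt_one
  have hne : μ0 ≠ μ1 := ne_of_lt hμ
  let z : Fin P.d → ℤ := -(e μ0) - e μ1
  have hz0 : z μ0 = -1 := by simp [z, e_apply, hne]
  have hz1 : (z + e μ0) μ1 = -1 := by simp [z, e_apply, hne.symm]
  have hz2 : (z + e μ1) μ0 = -1 := by simp [z, e_apply, hne]
  have hz3 : z + e μ0 + e μ1 = 0 := by simp only [z]; abel
  refine ⟨⟨castSite z, μ0, μ1, hμ⟩, ?_, castSite_notMem_cubeEnl hsN hz0, ?_, ?_, fun ν hν => ?_⟩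
  · show ((castSite z : Site P 0).shift μ0).shift μ1 ∈ cubeEnl P s 0 0
    rw [← castSite_add_e, ← castSite_add_e, hz3]
    exact castSite_zero_mem_cubeEnl hs
  · show (castSite z : Site P 0).shift μ0 ∉ cubeEnl P s 0 0
    rw [← castSite_add_e]
    exact castSite_notMem_cubeEnl hsN hz1
  · show (castSite z : Site P 0).shift μ1 ∉ cubeEnl P s 0 0
    rw [← castSite_add_e]
    exact castSite_notMem_cubeEnl hsN hz2
  · exact Nat.not_lt_zero _ (Fin.lt_def.mp hν)

end Corner

/-! ## §4  The one-step (2.18) index of record at a cube -/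

section OneStep

/-- With the exponent `r = 0` of (2.5), `R_j = 1` for every coupling (`(log g⁻²)⁰ = 1 ≤ L⁰`). [cite: Balaban1988Convergent, (2.5) p.255 (bookkeeping)] -/
theorem RkOfRecord_zero_r (L : ℕ) (g : ℝ) : RkOfRecord L 0 g = 1 := by
  unfold RkOfRecord
  have h : ∃ s : ℕ, (Real.log (g ^ 2)⁻¹) ^ 0 ≤ ((L ^ s : ℕ) : ℝ) := ⟨0, by simp⟩
  rw [dif_pos h, (Nat.find_eq_zero h).mpr (by simp), pow_zero]

variable (F : T4Family) (ν : Stage7Numerics) (M : ℕ) (g : ℕ → ℝ) (K : ℕ)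

/-- **A ONE-STEP INDEX `s` WITH `Ω₁ = Λ₁ =` ONE `𝐃₁`-CUBE** (the cube of index `0`, side `L·M·R₁`, a member of `𝐃₁ = unionsOfCubes …`; the (2.1) chain
conditions at `k = 1` are `Λ₁ ⊆ Ω₁` only). [cite: Balaban1988Convergent, (2.1) p.254, (2.18) p.257 (bookkeeping)] -/
theorem exists_seqOfRecord_one (hs : 1 ≤ dCubeSide (F.P K).L M (RkOfRecord (F.P K).L ν.r (g 1)) 1) :
    ∃ s : SeqOfRecord F ν M g K 1, s.Ω 1 = cubeEnl (F.P K) (dCubeSide (F.P K).L M (RkOfRecord (F.P K).L ν.r (g 1)) 1) 0 0 := by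
  set sd := dCubeSide (F.P K).L M (RkOfRecord (F.P K).L ν.r (g 1)) 1 with hsd
  have hn : 1 ≤ (F.P K).sitesPerDir 0 := Nat.one_le_iff_ne_zero.mpr ((F.P K).sitesPerDir_ne_zero 0)
  have hD : cubeEnl (F.P K) sd 0 0 ∈ DOfRecord F ν M g K 1 := by
    show cubeEnl (F.P K) sd 0 0 ∈ unionsOfCubes (F.P K) sd
    rw [mem_unionsOfCubes_iff]
    refine ⟨{0}, ?_, (Finset.set_biUnion_singleton (0 : B14DomainGeom.Pt (F.P K).d) (fun a => cubeEnl (F.P K) sd a 0)).symm⟩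
    intro a ha
    rw [Finset.mem_singleton] at ha
    subst ha
    unfold cubeIndices
    rw [Fintype.mem_piFinset]
    intro i
    rw [Finset.mem_image]
    exact ⟨0, Finset.mem_range.mpr (Nat.div_pos (by omega) (by omega)), by simp⟩
  have hch : Chain21 (DOfRecord F ν M g K) 1 (fun _ => cubeEnl (F.P K) sd 0 0) (fun _ => cubeEnl (F.P K) sd 0 0) :=
    { memΩ := fun j h1 hj => by obtain rfl : j = 1 := le_antisymm hj h1; exact hD
      memΛ := fun j h1 hj => by obtain rfl : j = 1 := le_antisymm hj h1; exact hD
      Λ_subset := fun _ _ _ => subset_rfl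
      Ω_succ_subset := fun j h1 hj => by omega }
  exact ⟨Seq.ofChain _ _ hch, Seq.ofChain_Ω hch le_rfl le_rfl⟩

end OneStep

/-! ## §5  ★ The pin at the `Γ₀ ∕ Ω₁` interface and ★★ the obstruction -/

section Pin

variable {P : Params} {G : Type*} [GaugeGroup G]

/-- ★ **THE INTERFACE PLAQUETTE IS DATA**: under the (2.10) constraint `M_𝔅(U) = W` on the determining set `𝔅 = genSet Ω k` (`k ≥ 1`), a fine plaquette whose
three near corners lie outside `Ω₁` has all four bonds sourced in `Γ₀ = Ω₁ᶜ` (scale `0`, where `M⁰ = id`), hence `U(∂p) = W₀(∂p)`.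
[cite: Balaban1988Convergent, (2.2) p.255, (2.10)–(2.11) p.256] -/
theorem plaqHol_eq_of_agreeOn (av : ∀ j, Averaging P j G) {k : ℕ} (hk : 0 < k) (Ω : ℕ → Set (Site P 0))
    {U : GaugeField P 0 G} {W : MSField P G} (hA : AgreeOn (genSet Ω k) (avgFamily av U) W) (p : Plaq P 0)
    (h1 : p.src ∉ Ω 1) (h2 : p.src.shift p.μ ∉ Ω 1) (h3 : p.src.shift p.ν ∉ Ω 1) :
    GaugeField.plaqHol U p = GaugeField.plaqHol (W 0) p := by
  have hb : ∀ b : PBond P 0, b.src ∉ Ω 1 → U b = W 0 b := by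
    intro b hb
    have hmem : b ∈ bondsOf (genSet Ω k 0) := by
      show b ∈ bondsOf (pts 0 (gammaRegion Ω k 0))
      rw [gammaRegion_zero Ω hk, pts_zero]
      exact Or.inl hb
    exact hA 0 b hmem
  unfold GaugeField.plaqHol
  rw [hb ⟨p.src, p.μ⟩ h1, hb ⟨p.src.shift p.μ, p.ν⟩ h2, hb ⟨p.src.shift p.ν, p.μ⟩ h3, hb ⟨p.src, p.ν⟩ h1]

/-- ★★ **THE OBSTRUCTION** (ANY class `reg`, any averaging, any `k ≥ 1`): if a plaquette `p` touching `Ω₁` has its three near corners outside `Ω₁` and the datum's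
value there has `dist1 (W₀(∂p)) ≥ B₃·δ₁·η₁²`, then «a minimiser exists AND every minimiser is `B₃δ_nη_n²`-regular on the plaquettes touching `Ω_n`, `n ≤ k`» is
FALSE — the regularity clause at `n = 1` contradicts the pin. [cite: Balaban1985Variational, Thm 1 (7)–(8) p.279; Balaban1985RegularSpaces, (1.7) p.77] -/
theorem not_exists_isMinimizer_and_regular (av : ∀ j, Averaging P j G) (reg : Set (GaugeField P 0 G)) {k : ℕ} (hk : 1 ≤ k)
    (Ω : ℕ → Set (Site P 0)) (W : MSField P G) (p : Plaq P 0) (hp : p ∈ omegaPlaqs Ω 1)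
    (h1 : p.src ∉ Ω 1) (h2 : p.src.shift p.μ ∉ Ω 1) (h3 : p.src.shift p.ν ∉ Ω 1) {B₃ : ℝ} {δ : ℕ → ℝ}
    (hc : B₃ * δ 1 * P.eta 1 ^ 2 ≤ dist1 (GaugeField.plaqHol (W 0) p)) :
    ¬ ((∃ U₀, IsMinimizer av reg (genSet Ω k) W U₀) ∧
       ∀ U₀, IsMinimizer av reg (genSet Ω k) W U₀ → ∀ n, n ≤ k → PlaqSmallOn (omegaPlaqs Ω n) (B₃ * δ n * P.eta n ^ 2) U₀) := by
  rintro ⟨⟨U₀, hU₀⟩, hR⟩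
  have h := hR U₀ hU₀ 1 hk p hp
  rw [plaqHol_eq_of_agreeOn av hk Ω hU₀.2.1 p h1 h2 h3] at h
  exact lt_irrefl _ (hc.trans_lt h)

end Pin

/-! ## §6  ★★ The interface instance of record (everything the three refutations read) -/

section Instance

variable (F : T4Family) {N : ℕ} [NeZero N]

/-- `η₁² = 1∕L²` on every torus of the family. [cite: Balaban1987RG1, (1.1) p.260 (bookkeeping)] -/
theorem eta_one_sq (K : ℕ) : (F.P K).eta 1 ^ 2 = 1 / (F.L : ℝ) ^ 2 := by
  simp [Params.eta, T4Family.P_L]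

/-- `η₁² ≤ 1`. [cite: Balaban1987RG1, (1.1) p.260 (bookkeeping)] -/
theorem eta_one_sq_le_one (K : ℕ) : (F.P K).eta 1 ^ 2 ≤ 1 := by
  rw [eta_one_sq]
  have hL : (1 : ℝ) ≤ F.L := by exact_mod_cast (show 1 ≤ F.L by have := F.hL.2; omega)
  rw [div_le_one (by positivity)]
  nlinarith

/-- ★★ **THE INTERFACE INSTANCE**: on the torus `F.P K`, for any group element `h`, a one-step index `s` (separated — vacuously), a datum `W` (`W₀` single-bond
with value `h`, `W_{j+1} = 1`) whose every scale-`0` plaquette holonomy has `dist1 ≤ dist1 h`, and a plaquette `p ∈ omegaPlaqs s.Ω 1` at which «minimiser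
exists ∧ every minimiser `B₃δ_nη_n²`-regular» fails for EVERY class, EVERY averaging and EVERY `(B₃, δ)` with `B₃δ₁η₁² ≤ dist1 h`.
[cite: Balaban1985Variational, Thm 1 (7)–(8) p.279; Balaban1988Convergent, (2.1)–(2.2) pp.254–255, (2.10)–(2.12) p.256] -/
theorem exists_interface_instance (K : ℕ) (h : SU N) :
    ∃ (ν : Stage7Numerics) (M : ℕ) (g : ℕ → ℝ) (s : SeqOfRecord F ν M g K 1) (W : MSField (F.P K) (SU N)) (p : Plaq (F.P K) 0),
      Sect2.SeqSeparated ν.M₁ s ∧ p ∈ omegaPlaqs s.Ω 1 ∧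
      (∀ q, dist1 (GaugeField.plaqHol (W 0) q) ≤ dist1 h) ∧ (∀ j, W (j + 1) = 1) ∧
      ∀ (av : ∀ j, Averaging (F.P K) j (SU N)) (reg : Set (GaugeField (F.P K) 0 (SU N))) {B₃ : ℝ} {δ : ℕ → ℝ},
        B₃ * δ 1 * (F.P K).eta 1 ^ 2 ≤ dist1 h →
        ¬ ((∃ U₀, IsMinimizer av reg (genSet s.Ω 1) W U₀) ∧
           ∀ U₀, IsMinimizer av reg (genSet s.Ω 1) W U₀ →
             ∀ n, n ≤ 1 → PlaqSmallOn (omegaPlaqs s.Ω n) (B₃ * δ n * (F.P K).eta n ^ 2) U₀) := by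
  -- the numerics: `r = 0` (so `R₁ = 1`), `M = 1`, `g ≡ 1`: the cube side is `L`
  let ν : Stage7Numerics := ⟨1, 1, 0, 0, 0, 0, 0, 0⟩
  have hside : dCubeSide (F.P K).L 1 (RkOfRecord (F.P K).L ν.r ((fun _ : ℕ => (1 : ℝ)) 1)) 1 = F.L := by
    simp [dCubeSide, RkOfRecord_zero_r, ν, T4Family.P_L]
  have hL1 : 1 ≤ F.L := by have := F.hL.2; omega
  have hsN : ((F.L : ℕ) : ℤ) < (F.P K).sitesPerDir 0 := by
    have h1 : F.L ≤ F.L ^ (F.m + K) := Nat.le_self_pow (by have := F.hm; omega) F.L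
    have h2 : (F.P K).sitesPerDir 0 = 2 * F.L ^ (F.m + K) := by simp [Params.sitesPerDir, T4Family.P_L, T4Family.P_m, T4Family.P_K]
    rw [h2]; push_cast; exact_mod_cast (show F.L < 2 * F.L ^ (F.m + K) by omega)
  have hd : 2 ≤ (F.P K).d := by rw [T4Family.P_d]; norm_num
  obtain ⟨s, hsΩ⟩ := exists_seqOfRecord_one F ν 1 (fun _ => (1 : ℝ)) K (by rw [hside]; exact hL1)
  rw [hside] at hsΩ
  obtain ⟨p, hfar, h1, h2, h3, hmin⟩ := exists_cornerPlaq (P := F.P K) hL1 hsN hd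
  let W₀ : GaugeField (F.P K) 0 (SU N) := fun b => if b.src = p.src ∧ b.dir = p.μ then h else 1
  let W : MSField (F.P K) (SU N) := fun j => match j with
    | 0 => W₀
    | _ + 1 => 1
  have hW0 : W 0 = W₀ := rfl
  have hhol : GaugeField.plaqHol (W 0) p = h := by
    rw [hW0]
    exact plaqHol_single_eq p.src p.hμν h
  refine ⟨ν, 1, fun _ => 1, s, W, p, fun n hn1 hn => by omega, ?_, fun q => ?_, fun j => rfl, ?_⟩
  · rw [omegaPlaqs_of_ne_zero s.Ω one_ne_zero, hsΩ]
    exact Or.inr (Or.inr (Or.inr hfar))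
  · rw [hW0]
    exact dist1_plaqHol_single_le p.src hmin h q
  · intro av reg B₃ δ hc
    refine not_exists_isMinimizer_and_regular av reg le_rfl s.Ω W p ?_ ?_ ?_ ?_ (by rwa [hhol])
    · rw [omegaPlaqs_of_ne_zero s.Ω one_ne_zero, hsΩ]
      exact Or.inr (Or.inr (Or.inr hfar))
    · rw [hsΩ]; exact h1
    · rw [hsΩ]; exact h2
    · rw [hsΩ]; exact h3

end Instance

end Summit.QuantumFields.YangMills.BalabanUVNodes.N07Thm1ScaledInterfaceInstance

end
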